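import Summits.CriticalPhenomena.SAWScalingLimit.Theorems.SAWRenewalTightnessAnnularMassDecaySkipFirstEntryIrr
import Summits.CriticalPhenomena.SAWScalingLimit.Theorems.SAWRenewalTightnessAnnularMassDecaySkipStructure
import Summits.CriticalPhenomena.SAWScalingLimit.Theorems.SAWRenewalTightnessAnnularMassDecayLastRenewalBalance

/-!
# Skip tail (stub S3): its logical position — chain boundedness (S1) plus the CONDITIONAL targeting
# tail of ONE radially irreducible descent (line `radial-renewal-kesten-inequality`, crux `AnnularMassDecay`)

Registered helper for the OPEN stub S3 `stub_skipTail` of stmt-CriticalPhenomena-4729 (NOT a proof of S3: it records S3's logical position).  Notation: `ρ_u = dist (Site.toComplex u) z`, `L = ρ_u/A` (renewal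
level), `s = ρ_u/(A·B)` (landing level), `Skip(u;A,s)[N]` the skip mass (level-`L` chain-stopped
members from `u` with end radius `≤ s`), `D(u;s)[N]` the chain-stopped mass, `Irr_{≤ x}(v)[N]` the
`x_c`-mass of radially IRREDUCIBLE record-ending descents from `v` (confined to the open disc of radius
`ρ_v` after time `0`, end = strict record, no radial renewal time) with end radius `≤ x`.  Everything is
spelled out over `SAW.Zd.saws`, `SAW.criticalFugacity`, `Site.toComplex`; no definitions.

* `rr_sk_firstEntry_factorisation_top` — first-entry cut AT THE RENEWAL LEVEL `L` (the tree's
  `rr_st_firstEntry_factorisation_irr` cuts at the landing level `s`):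
  `Skip(u;A,s)[N] ≤ Σ_β x_c^{|β|} · RetIrr₂(u + β_m; s, L, ρ_u)[N] + Direct(u;A,s)[N]`, `β` over the
  annular bridges from `u` into the closed `L`-disc, `RetIrr₂(w; s, L, ρ)` the returning radially
  irreducible descents from `w` confined to the open `ρ`-disc with end radius `≤ s`, `Direct` the
  annular bridges with interior radii in `(L, ρ_u)` and end radius `≤ s`;
  `rr_sk_direct_eq_zero` — `Direct = 0` once `L - s ≥ 1` (unit steps).  This is the structure behind
  route (b) of the brief; it is IDLE as a route: `Σ_β x_c^{|β|} = annMass` at fixed ratio `A` decays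
  like `ρ_u^{-1/4}` (crux numerics `M(r,2r) ≈ 0.29 r^{-1/4}`; flat shadow `B_T(x_c) ≍ T^{-1/4}`) while
  `Skip` is scale-free, so the returning factor `RetIrr` GROWS like `ρ_u^{1/4}` (flat shadow: the
  completion factor `Z' ≍ T^{1/4}`): the hypothesis `RetIrr ≤ K` of `rr_st_skipTail_of_annularDecay_irr`
  is presumably false, exactly like hypothesis (ii) of `rr_st_skipTail_of_annularDecay`.
* `rr_sk_skipTail_of_chainBounded_of_irrCondTail` — **S1 ∧ IrrCondTail ⟹ S3** (S3 verbatim, same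
  `κ`, constant `max C 0 · max K₀ 0`), by the exact last-renewal cut `rr_lr_cut_identity` (twice) and
  `rr_st_le_stable`.  `IrrCondTail` (hypothesis `h₂`, spelled out) is the missing single-piece estimate:
  for `1 ≤ B ≤ L`, `ρ_v/A ≤ L < ρ_v`, `N ≥ N₀(v,z)`: `Irr_{≤ L/B}(v)[N] ≤ C·B^{-κ}·Irr_{≤ L}(v)[N]` —
  a CONDITIONAL one-arm/targeting tail with a rate for one radially irreducible critical descent,
  scale-free (both sides carry the same span factor), open on `ℤ²` (no polynomial upper bound on a
  critical `x_c`-mass ratio is in print; the renewal formalism alone cannot give it: in the flat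
  shadow `Skip` does not decay in `B` at all, the decay is a two-dimensional targeting effect).

Sources: H. Kesten, J. Math. Phys. 4 (1963) §4; N. Madras, G. Slade, *The Self-Avoiding Walk* (1993)
§4.2. [folklore]
-/

noncomputable section

namespace Summit.CriticalPhenomena.SAWScalingLimit.Theorems.AnnularMassDecay.Radial

open scoped BigOperators Classical
open Literature.Probability.LatticeModels Literature.Probability.RandomPlanarGeometry
open Summit.CriticalPhenomena.SAWScalingLimit.Theorems.AnnularMassDecay.Negative (criticalFugacity_pos)

/-! ### Unit steps -/

/-- Consecutive points of a (translated) self-avoiding walk are at distance one. [folklore] -/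
theorem rr_sk_dist_step {n i : ℕ} {ω : ℕ → Site 2} (hω : ω ∈ SAW.Zd.saws 2 n) (hi : i < n)
    (u : Site 2) :
    dist (Site.toComplex (u + ω i)) (Site.toComplex (u + ω (i + 1))) = 1 := by
  obtain ⟨-, -, hadj, -⟩ := SAW.Zd.mem_saws.1 hω
  have h' : (zdGraph 2).Adj (u + ω i) (u + ω (i + 1)) := by
    rw [add_comm u, add_comm u]
    exact (SAW.Zd.zdGraph_adj_add_right _ _ u).2 (hadj i hi)
  exact dist_toComplex_of_adj h'

/-- Consecutive radii about any centre differ by at most one. [folklore] -/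
theorem rr_sk_radius_step {n i : ℕ} {ω : ℕ → Site 2} (hω : ω ∈ SAW.Zd.saws 2 n) (hi : i < n)
    (u : Site 2) (z : ℂ) :
    dist (Site.toComplex (u + ω i)) z ≤ dist (Site.toComplex (u + ω (i + 1))) z + 1 := by
  have h := dist_triangle (Site.toComplex (u + ω i)) (Site.toComplex (u + ω (i + 1))) z
  rw [rr_sk_dist_step hω hi u] at h
  linarith

/-! ### The first-entry cut at the renewal level -/

/-- **First-entry factorisation of the skip mass at the renewal level.**  For `A > 1`, a centre
`z`, a start `u`, a landing level `s ≤ L := dist (Site.toComplex u) z / A` and `N`: cutting a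
skipping member (level-`L` chain-stopped member with end radius `≤ s`) at its first entry `t₁` into
the closed `L`-disc gives either the member itself (`t₁ = n`: an annular bridge with interior radii
in `(L, dist (Site.toComplex u) z)` and end radius `≤ s`, the last sum) or an annular bridge `β`
into the closed `L`-disc followed by a walk from `u + β m` confined to the open disc of radius
`dist (Site.toComplex u) z`, ending at a strict record of radius `≤ s`, returning to radius
`≥ dist (Site.toComplex (u + β m)) z` (as `t₁ < n` is a record of radius `≤ L`, hence not a
renewal), with no renewal of radius `≤ L` (a renewal of the suffix would be one of the member);
the cut is injective and the weights multiply. [folklore] -/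
theorem rr_sk_firstEntry_factorisation_top :
    ∀ A : ℝ, 1 < A → ∀ (z : ℂ) (u : Site 2) (s : ℝ), s ≤ dist (Site.toComplex u) z / A → ∀ N : ℕ,
      (∑ n ∈ Finset.range (N + 1),
        ∑ _ω ∈ (SAW.Zd.saws 2 n).filter (fun ω =>
          dist (Site.toComplex (u + ω n)) z ≤ s ∧
          0 < n ∧
          (∀ i, 0 < i → i ≤ n → dist (Site.toComplex (u + ω i)) z < dist (Site.toComplex u) z) ∧
          (∀ i, i < n → dist (Site.toComplex (u + ω n)) z < dist (Site.toComplex (u + ω i)) z) ∧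
          dist (Site.toComplex (u + ω n)) z ≤ dist (Site.toComplex u) z / A ∧
          (∀ t, 0 < t → t < n →
            (∀ i, i < t → dist (Site.toComplex (u + ω t)) z < dist (Site.toComplex (u + ω i)) z) →
            (∀ j, t < j → j ≤ n → dist (Site.toComplex (u + ω j)) z < dist (Site.toComplex (u + ω t)) z) →
            dist (Site.toComplex u) z / A < dist (Site.toComplex (u + ω t)) z)),
          SAW.criticalFugacity ^ n) ≤
      (∑ m ∈ Finset.range (N + 1),
        ∑ η ∈ (SAW.Zd.saws 2 m).filter (fun η =>
            (∀ i, 0 < i → i < m → dist (Site.toComplex u) z / A < dist (Site.toComplex (u + η i)) z ∧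
              dist (Site.toComplex (u + η i)) z < dist (Site.toComplex u) z) ∧
            dist (Site.toComplex (u + η m)) z ≤ dist (Site.toComplex u) z / A),
          SAW.criticalFugacity ^ m *
            (∑ k ∈ Finset.range (N + 1),
                ∑ _τ ∈ (SAW.Zd.saws 2 k).filter (fun τ =>
                  0 < k ∧
                  (∀ i, i ≤ k → dist (Site.toComplex (u + η m + τ i)) z < dist (Site.toComplex u) z) ∧
                  (∀ i, i < k → dist (Site.toComplex (u + η m + τ k)) z <
                    dist (Site.toComplex (u + η m + τ i)) z) ∧
                  dist (Site.toComplex (u + η m + τ k)) z ≤ s ∧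
                  (∃ j, 0 < j ∧ j < k ∧ dist (Site.toComplex (u + η m)) z ≤
                    dist (Site.toComplex (u + η m + τ j)) z) ∧
                  (∀ t, 0 < t → t < k →
                    (∀ i, i < t → dist (Site.toComplex (u + η m + τ t)) z <
                      dist (Site.toComplex (u + η m + τ i)) z) →
                    (∀ j, t < j → j ≤ k → dist (Site.toComplex (u + η m + τ j)) z <
                      dist (Site.toComplex (u + η m + τ t)) z) →
                    dist (Site.toComplex u) z / A < dist (Site.toComplex (u + η m + τ t)) z)),
                  SAW.criticalFugacity ^ k)) +
      (∑ n ∈ Finset.range (N + 1),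
        ∑ _ω ∈ (SAW.Zd.saws 2 n).filter (fun ω =>
          (∀ i, 0 < i → i < n → dist (Site.toComplex u) z / A < dist (Site.toComplex (u + ω i)) z ∧
            dist (Site.toComplex (u + ω i)) z < dist (Site.toComplex u) z) ∧
          dist (Site.toComplex (u + ω n)) z ≤ s),
          SAW.criticalFugacity ^ n) := by
  intro A _ z u s hs N
  refine rr_fd_abstract_factorisation (α := ℕ → Site 2) criticalFugacity_pos.le N (SAW.Zd.saws 2)
    _ _ _ _
    (fun n ω t => 0 < t ∧ t < n ∧ dist (Site.toComplex (u + ω t)) z ≤ dist (Site.toComplex u) z / A)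
    (fun _ ω t => fun i => ω (min i t)) (fun n ω t => fun i => ω (t + min i (n - t)) - ω t)
    ?_ ?_ ?_
  · -- no entry into the `L`-disc before the end: a direct member
    intro n ω _ hC hno
    obtain ⟨hns, -, hconf, -, -, -⟩ := hC
    refine ⟨fun i hi0 hin => ⟨?_, hconf i hi0 hin.le⟩, hns⟩
    by_contra hle
    exact hno i ⟨hi0, hin, not_lt.1 hle⟩
  · -- the cut at the first entry into the `L`-disc
    intro n ω t hω hC hgood hmin
    obtain ⟨ht0, htn, htL⟩ := hgood
    have h0 : dist (Site.toComplex (u + ω 0)) z = dist (Site.toComplex u) z := by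
      rw [(SAW.Zd.mem_saws.1 hω).1, add_zero]
    refine ⟨htn.le, rr_fd_prefix_mem_saws hω htn.le, ?_, rr_fd_suffix_mem_saws hω htn.le, ?_⟩
    · -- the prefix up to the first entry is an annular bridge into the `L`-disc
      refine ⟨fun i hi0 hit => ?_, by simpa only [min_self] using htL⟩
      simp only [min_eq_left hit.le]
      refine ⟨?_, hC.2.2.1 i hi0 (hit.le.trans htn.le)⟩
      by_contra hle
      exact hmin i hit ⟨hi0, hit.trans htn, not_lt.1 hle⟩
    · -- the suffix: returning, radially irreducible, end radius `≤ s`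
      have key := rr_st_profile_suffix_irr (r := fun k => dist (Site.toComplex (u + ω k)) z)
        (r'' := fun i =>
          dist (Site.toComplex (u + ω (min t t) + (ω (t + min i (n - t)) - ω t))) z)
        (ρw := dist (Site.toComplex (u + ω (min t t))) z)
        ⟨hC.2.2.2.2.1, hC.2⟩ le_rfl h0 ht0 htn htL hmin (by simp only [min_self])
        (fun i hi => by simp only [min_self, min_eq_left hi, add_add_sub_cancel])
      obtain ⟨hk, hconf', hrec', -, hret', hren'⟩ := key
      refine ⟨hk, hconf', hrec', ?_, hret', hren'⟩
      show dist (Site.toComplex (u + ω (min t t) + (ω (t + min (n - t) (n - t)) - ω t))) z ≤ s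
      simp only [min_self, Nat.add_sub_of_le htn.le, add_add_sub_cancel]
      exact hC.1
  · -- injectivity of the cut
    exact fun t n ω n' ω' hω hω' htn htn' h1 h2 h3 => rr_fd_cut_injective hω hω' htn htn' h1 h2 h3

/-! ### The direct term vanishes above the lattice scale -/

/-- **No direct jump.** If `1 ≤ L - s`, no walk from `u` has interior radii `> L` (and start radius
`dist (Site.toComplex u) z > L`) and end radius `≤ s`: the last step has length one.  Hence the
direct term of `rr_sk_firstEntry_factorisation_top` vanishes. [folklore] -/
theorem rr_sk_direct_eq_zero (z : ℂ) (u : Site 2) (s L : ℝ) (N : ℕ)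
    (hL : L < dist (Site.toComplex u) z) (hgap : 1 ≤ L - s) :
    (∑ n ∈ Finset.range (N + 1),
        ∑ _ω ∈ (SAW.Zd.saws 2 n).filter (fun ω =>
          (∀ i, 0 < i → i < n → L < dist (Site.toComplex (u + ω i)) z ∧
            dist (Site.toComplex (u + ω i)) z < dist (Site.toComplex u) z) ∧
          dist (Site.toComplex (u + ω n)) z ≤ s),
          SAW.criticalFugacity ^ n) = 0 := by
  refine Finset.sum_eq_zero fun n _ => Finset.sum_eq_zero fun ω hω => ?_
  exfalso
  obtain ⟨hωs, hint, hend⟩ := Finset.mem_filter.1 hω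
  have h0 : ω 0 = 0 := (SAW.Zd.mem_saws.1 hωs).1
  have hn : 0 < n := by
    rcases Nat.eq_zero_or_pos n with rfl | hn
    · rw [h0, add_zero] at hend
      linarith
    · exact hn
  have hprev : L < dist (Site.toComplex (u + ω (n - 1))) z := by
    rcases Nat.eq_zero_or_pos (n - 1) with h | h
    · rw [h, h0, add_zero]
      exact hL
    · exact (hint (n - 1) h (by omega)).1
  have hstep := rr_sk_radius_step hωs (show n - 1 < n by omega) u z
  rw [Nat.sub_add_cancel hn] at hstep
  linarith

/-! ### S3 from S1 and the CONDITIONAL targeting tail of one radially irreducible descent -/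

/-- **`ChainBounded ∧ IrrCondTail ⟹ SkipTail`** (the logical position of S3).  Hypotheses:
(S1, verbatim `stub_chainBounded`) `D(u;s)[N] ≤ K₀` for `1 ≤ s`; (IrrCondTail — the MISSING
ESTIMATE, spelled out) for every `A > 1` there are `κ > 0`, `C` with: for `1 ≤ B ≤ L`,
`dist (Site.toComplex v) z / A ≤ L < dist (Site.toComplex v) z` and `N ≥ (2⌈dist (Site.toComplex v) z⌉₊ + 3)²`,
`Irr_{≤ L/B}(v)[N] ≤ C · B^{-κ} · Irr_{≤ L}(v)[N]`, where `Irr_{≤ x}(v)[N]` is the `x_c`-mass of the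
radially IRREDUCIBLE record-ending descents from `v` (confined to the open disc of radius
`dist (Site.toComplex v) z` about `z` after time `0`, end = strict radial record, no radial renewal
time at all) whose end radius is `≤ x` — i.e. GIVEN that one irreducible descent from `v` ends
inside the `L`-disc (`L ≥` the fixed fraction `1/A` of its own radius), the `x_c`-fraction ending
inside the `B` times smaller disc is `≤ C B^{-κ}` (a conditional one-arm / targeting tail with a rate,
scale-free).  Conclusion: S3 verbatim, same `κ`, constant `max C 0 · max K₀ 0`.
Proof: `Skip(u;A,s)[N] ≤ Skip(u;A,s)[N₀]` (`rr_st_le_stable`); the last-renewal cut identity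
`rr_lr_cut_identity` at level `L = dist (Site.toComplex u) z / A` with `Q = (· ≤ L/B)` writes
`Skip(u;A,L/B)[N₀] = Σ_η x_c^{|η|} Irr_{≤ L/B}(u + η_m)[N₀]` over the record-ending prefixes `η` with
end radius in `(L, dist (Site.toComplex u) z]`; apply IrrCondTail termwise (`L ≥ B ≥ 1`); the same
identity with `Q = (· ≤ L)` folds `Σ_η x_c^{|η|} Irr_{≤ L}(u + η_m)[N₀]` back into `D(u;L)[N₀] ≤ K₀`
(S1). [folklore] -/
theorem rr_sk_skipTail_of_chainBounded_of_irrCondTail :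
    (∃ K₀ : ℝ, ∀ (z : ℂ) (u : Site 2) (s : ℝ), 1 ≤ s → ∀ N : ℕ,
      (∑ n ∈ Finset.range (N + 1),
        ∑ _ω ∈ (SAW.Zd.saws 2 n).filter (fun ω =>
          0 < n ∧
          (∀ i, 0 < i → i ≤ n → dist (Site.toComplex (u + ω i)) z < dist (Site.toComplex u) z) ∧
          (∀ i, i < n → dist (Site.toComplex (u + ω n)) z < dist (Site.toComplex (u + ω i)) z) ∧
          dist (Site.toComplex (u + ω n)) z ≤ s ∧
          (∀ t, 0 < t → t < n →
            (∀ i, i < t → dist (Site.toComplex (u + ω t)) z < dist (Site.toComplex (u + ω i)) z) →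
            (∀ j, t < j → j ≤ n → dist (Site.toComplex (u + ω j)) z < dist (Site.toComplex (u + ω t)) z) →
            s < dist (Site.toComplex (u + ω t)) z)),
          SAW.criticalFugacity ^ n) ≤ K₀) →
    (∀ A : ℝ, 1 < A → ∃ κ C : ℝ, 0 < κ ∧ ∀ B : ℝ, 1 ≤ B → ∀ (z : ℂ) (v : Site 2) (L : ℝ),
      dist (Site.toComplex v) z / A ≤ L → L < dist (Site.toComplex v) z → B ≤ L →
      ∀ N : ℕ, (2 * ⌈dist (Site.toComplex v) z⌉₊ + 3) ^ 2 ≤ N →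
      (∑ k ∈ Finset.range (N + 1),
        ∑ _τ ∈ (SAW.Zd.saws 2 k).filter (fun τ =>
          dist (Site.toComplex (v + τ k)) z ≤ L / B ∧
          0 < k ∧
          (∀ i, 0 < i → i ≤ k → dist (Site.toComplex (v + τ i)) z < dist (Site.toComplex v) z) ∧
          (∀ i, i < k → dist (Site.toComplex (v + τ k)) z < dist (Site.toComplex (v + τ i)) z) ∧
          dist (Site.toComplex (v + τ k)) z ≤ dist (Site.toComplex v) z ∧
          (∀ t, 0 < t → t < k →
            (∀ i, i < t → dist (Site.toComplex (v + τ t)) z < dist (Site.toComplex (v + τ i)) z) →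
            (∀ j, t < j → j ≤ k → dist (Site.toComplex (v + τ j)) z < dist (Site.toComplex (v + τ t)) z) →
            dist (Site.toComplex v) z < dist (Site.toComplex (v + τ t)) z)),
          SAW.criticalFugacity ^ k) ≤
      C * B ^ (-κ) *
      (∑ k ∈ Finset.range (N + 1),
        ∑ _τ ∈ (SAW.Zd.saws 2 k).filter (fun τ =>
          dist (Site.toComplex (v + τ k)) z ≤ L ∧
          0 < k ∧
          (∀ i, 0 < i → i ≤ k → dist (Site.toComplex (v + τ i)) z < dist (Site.toComplex v) z) ∧
          (∀ i, i < k → dist (Site.toComplex (v + τ k)) z < dist (Site.toComplex (v + τ i)) z) ∧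
          dist (Site.toComplex (v + τ k)) z ≤ dist (Site.toComplex v) z ∧
          (∀ t, 0 < t → t < k →
            (∀ i, i < t → dist (Site.toComplex (v + τ t)) z < dist (Site.toComplex (v + τ i)) z) →
            (∀ j, t < j → j ≤ k → dist (Site.toComplex (v + τ j)) z < dist (Site.toComplex (v + τ t)) z) →
            dist (Site.toComplex v) z < dist (Site.toComplex (v + τ t)) z)),
          SAW.criticalFugacity ^ k)) →
    ∀ A : ℝ, 1 < A → ∃ κ C : ℝ, 0 < κ ∧ ∀ B : ℝ, 1 ≤ B → ∀ (z : ℂ) (u : Site 2),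
      A * B ≤ dist (Site.toComplex u) z → ∀ N : ℕ,
      (∑ n ∈ Finset.range (N + 1),
        ∑ _ω ∈ (SAW.Zd.saws 2 n).filter (fun ω =>
          dist (Site.toComplex (u + ω n)) z ≤ dist (Site.toComplex u) z / (A * B) ∧
          0 < n ∧
          (∀ i, 0 < i → i ≤ n → dist (Site.toComplex (u + ω i)) z < dist (Site.toComplex u) z) ∧
          (∀ i, i < n → dist (Site.toComplex (u + ω n)) z < dist (Site.toComplex (u + ω i)) z) ∧
          dist (Site.toComplex (u + ω n)) z ≤ dist (Site.toComplex u) z / A ∧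
          (∀ t, 0 < t → t < n →
            (∀ i, i < t → dist (Site.toComplex (u + ω t)) z < dist (Site.toComplex (u + ω i)) z) →
            (∀ j, t < j → j ≤ n → dist (Site.toComplex (u + ω j)) z < dist (Site.toComplex (u + ω t)) z) →
            dist (Site.toComplex u) z / A < dist (Site.toComplex (u + ω t)) z)),
          SAW.criticalFugacity ^ n) ≤ C * B ^ (-κ) := by
  intro h₁ h₂ A hA
  obtain ⟨K₀, hK⟩ := h₁
  obtain ⟨κ, C, hκ, hC⟩ := h₂ A hA
  refine ⟨κ, max C 0 * max K₀ 0, hκ, fun B hB z u hAB N => ?_⟩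
  have hA0 : 0 < A := by linarith
  have hABpos : 0 < A * B := by positivity
  have hB0 : 0 < B := by linarith
  have hρpos : 0 < dist (Site.toComplex u) z := lt_of_lt_of_le hABpos hAB
  have hL1 : B ≤ dist (Site.toComplex u) z / A := by
    rw [le_div_iff₀ hA0]; linarith [mul_comm A B]
  have hL1' : 1 ≤ dist (Site.toComplex u) z / A := hB.trans hL1
  have hsL : dist (Site.toComplex u) z / (A * B) ≤ dist (Site.toComplex u) z / A :=
    div_le_div_of_nonneg_left hρpos.le hA0 (by nlinarith)
  have hLρ : dist (Site.toComplex u) z / A < dist (Site.toComplex u) z := div_lt_self hρpos hA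
  have hx : 0 ≤ SAW.criticalFugacity := criticalFugacity_pos.le
  have hBκ : 0 ≤ B ^ (-κ) := Real.rpow_nonneg hB0.le _
  -- (1) pass to the stable truncation `N₀ = (2⌈ρ_u⌉₊ + 3)²`
  refine (rr_st_le_stable A z u (dist (Site.toComplex u) z / (A * B)) N).trans ?_
  -- (2) the skip family is the level-`L` family with end predicate `(· ≤ s)`
  have hskip_eq :
      (∑ n ∈ Finset.range ((2 * ⌈dist (Site.toComplex u) z⌉₊ + 3) ^ 2 + 1),
        ∑ _ω ∈ (SAW.Zd.saws 2 n).filter (fun ω =>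
          dist (Site.toComplex (u + ω n)) z ≤ dist (Site.toComplex u) z / (A * B) ∧
          0 < n ∧
          (∀ i, 0 < i → i ≤ n → dist (Site.toComplex (u + ω i)) z < dist (Site.toComplex u) z) ∧
          (∀ i, i < n → dist (Site.toComplex (u + ω n)) z < dist (Site.toComplex (u + ω i)) z) ∧
          dist (Site.toComplex (u + ω n)) z ≤ dist (Site.toComplex u) z / A ∧
          (∀ t, 0 < t → t < n →
            (∀ i, i < t → dist (Site.toComplex (u + ω t)) z < dist (Site.toComplex (u + ω i)) z) →
            (∀ j, t < j → j ≤ n → dist (Site.toComplex (u + ω j)) z < dist (Site.toComplex (u + ω t)) z) →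
            dist (Site.toComplex u) z / A < dist (Site.toComplex (u + ω t)) z)),
          SAW.criticalFugacity ^ n) =
      ∑ n ∈ Finset.range ((2 * ⌈dist (Site.toComplex u) z⌉₊ + 3) ^ 2 + 1),
        ∑ _ω ∈ (SAW.Zd.saws 2 n).filter (fun ω =>
          0 < n ∧
          (∀ i, 0 < i → i ≤ n → dist (Site.toComplex (u + ω i)) z < dist (Site.toComplex u) z) ∧
          (∀ i, i < n → dist (Site.toComplex (u + ω n)) z < dist (Site.toComplex (u + ω i)) z) ∧
          dist (Site.toComplex (u + ω n)) z ≤ dist (Site.toComplex u) z / (A * B) ∧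
          (∀ t, 0 < t → t < n →
            (∀ i, i < t → dist (Site.toComplex (u + ω t)) z < dist (Site.toComplex (u + ω i)) z) →
            (∀ j, t < j → j ≤ n → dist (Site.toComplex (u + ω j)) z < dist (Site.toComplex (u + ω t)) z) →
            dist (Site.toComplex u) z / A < dist (Site.toComplex (u + ω t)) z)),
          SAW.criticalFugacity ^ n := by
    refine Finset.sum_congr rfl fun n _ => Finset.sum_congr (Finset.filter_congr fun ω _ => ?_)
      fun _ _ => rfl
    constructor
    · rintro ⟨hns, hn, hconf, hrec, -, hren⟩
      exact ⟨hn, hconf, hrec, hns, hren⟩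
    · rintro ⟨hn, hconf, hrec, hns, hren⟩
      exact ⟨hns, hn, hconf, hrec, hns.trans hsL, hren⟩
  have hid₁ := rr_lr_cut_identity (fun x => x ≤ dist (Site.toComplex u) z / (A * B)) z u
    (dist (Site.toComplex u) z / A) ((2 * ⌈dist (Site.toComplex u) z⌉₊ + 3) ^ 2) hLρ le_rfl
  have hid₂ := rr_lr_cut_identity (fun x => x ≤ dist (Site.toComplex u) z / A) z u
    (dist (Site.toComplex u) z / A) ((2 * ⌈dist (Site.toComplex u) z⌉₊ + 3) ^ 2) hLρ le_rfl
  rw [hskip_eq, hid₁]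
  -- (3) termwise: the conditional tail of the irreducible descent from `u + η m`
  have hterm : ∀ (m : ℕ) (η : ℕ → Site 2), η ∈ (SAW.Zd.saws 2 m).filter (fun η =>
        dist (Site.toComplex u) z / A < dist (Site.toComplex (u + η m)) z ∧
        (∀ i, 0 < i → i ≤ m → dist (Site.toComplex (u + η i)) z < dist (Site.toComplex u) z) ∧
        (∀ i, i < m → dist (Site.toComplex (u + η m)) z < dist (Site.toComplex (u + η i)) z)) →
      SAW.criticalFugacity ^ m *
        (∑ k ∈ Finset.range ((2 * ⌈dist (Site.toComplex u) z⌉₊ + 3) ^ 2 + 1),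
          ∑ _τ ∈ (SAW.Zd.saws 2 k).filter (fun τ =>
            dist (Site.toComplex (u + η m + τ k)) z ≤ dist (Site.toComplex u) z / (A * B) ∧
            0 < k ∧
            (∀ i, 0 < i → i ≤ k →
              dist (Site.toComplex (u + η m + τ i)) z < dist (Site.toComplex (u + η m)) z) ∧
            (∀ i, i < k →
              dist (Site.toComplex (u + η m + τ k)) z < dist (Site.toComplex (u + η m + τ i)) z) ∧
            dist (Site.toComplex (u + η m + τ k)) z ≤ dist (Site.toComplex (u + η m)) z ∧
            (∀ t, 0 < t → t < k →
              (∀ i, i < t →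
                dist (Site.toComplex (u + η m + τ t)) z < dist (Site.toComplex (u + η m + τ i)) z) →
              (∀ j, t < j → j ≤ k →
                dist (Site.toComplex (u + η m + τ j)) z < dist (Site.toComplex (u + η m + τ t)) z) →
              dist (Site.toComplex (u + η m)) z < dist (Site.toComplex (u + η m + τ t)) z)),
            SAW.criticalFugacity ^ k) ≤
      SAW.criticalFugacity ^ m * (max C 0 * B ^ (-κ) *
        (∑ k ∈ Finset.range ((2 * ⌈dist (Site.toComplex u) z⌉₊ + 3) ^ 2 + 1),
          ∑ _τ ∈ (SAW.Zd.saws 2 k).filter (fun τ =>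
            dist (Site.toComplex (u + η m + τ k)) z ≤ dist (Site.toComplex u) z / A ∧
            0 < k ∧
            (∀ i, 0 < i → i ≤ k →
              dist (Site.toComplex (u + η m + τ i)) z < dist (Site.toComplex (u + η m)) z) ∧
            (∀ i, i < k →
              dist (Site.toComplex (u + η m + τ k)) z < dist (Site.toComplex (u + η m + τ i)) z) ∧
            dist (Site.toComplex (u + η m + τ k)) z ≤ dist (Site.toComplex (u + η m)) z ∧
            (∀ t, 0 < t → t < k →
              (∀ i, i < t →
                dist (Site.toComplex (u + η m + τ t)) z < dist (Site.toComplex (u + η m + τ i)) z) →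
              (∀ j, t < j → j ≤ k →
                dist (Site.toComplex (u + η m + τ j)) z < dist (Site.toComplex (u + η m + τ t)) z) →
              dist (Site.toComplex (u + η m)) z < dist (Site.toComplex (u + η m + τ t)) z)),
            SAW.criticalFugacity ^ k)) := by
    intro m η hη
    obtain ⟨hηs, hLr, hconf, -⟩ := Finset.mem_filter.1 hη
    have hrv : dist (Site.toComplex (u + η m)) z ≤ dist (Site.toComplex u) z := by
      rcases Nat.eq_zero_or_pos m with rfl | hm
      · rw [(SAW.Zd.mem_saws.1 hηs).1, add_zero]
      · exact (hconf m hm le_rfl).le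
    have hvA : dist (Site.toComplex (u + η m)) z / A ≤ dist (Site.toComplex u) z / A :=
      div_le_div_of_nonneg_right hrv hA0.le
    have hNv : (2 * ⌈dist (Site.toComplex (u + η m)) z⌉₊ + 3) ^ 2 ≤
        (2 * ⌈dist (Site.toComplex u) z⌉₊ + 3) ^ 2 := by
      have := Nat.ceil_mono hrv
      gcongr
    have key := hC B hB z (u + η m) (dist (Site.toComplex u) z / A) hvA hLr hL1 _ hNv
    rw [div_div] at key
    refine mul_le_mul_of_nonneg_left (key.trans ?_) (pow_nonneg hx m)
    refine mul_le_mul_of_nonneg_right (mul_le_mul_of_nonneg_right (le_max_left _ _) hBκ) ?_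
    exact Finset.sum_nonneg fun k _ => Finset.sum_nonneg fun _ _ => pow_nonneg hx k
  refine (Finset.sum_le_sum fun m _ => Finset.sum_le_sum fun η hη => hterm m η hη).trans ?_
  -- (4) factor the constant and fold back into `D(u;L)[N₀] ≤ K₀`
  have hfac : ∀ (S : ℕ → Finset (ℕ → Site 2)) (I : ℕ → (ℕ → Site 2) → ℝ) (c : ℝ),
      (∑ m ∈ Finset.range ((2 * ⌈dist (Site.toComplex u) z⌉₊ + 3) ^ 2 + 1), ∑ η ∈ S m,
          SAW.criticalFugacity ^ m * (c * I m η)) =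
        c * ∑ m ∈ Finset.range ((2 * ⌈dist (Site.toComplex u) z⌉₊ + 3) ^ 2 + 1), ∑ η ∈ S m,
          SAW.criticalFugacity ^ m * I m η := by
    intro S I c
    rw [Finset.mul_sum]
    refine Finset.sum_congr rfl fun m _ => ?_
    rw [Finset.mul_sum]
    exact Finset.sum_congr rfl fun _ _ => by ring
  rw [hfac, ← hid₂]
  have hD := hK z u (dist (Site.toComplex u) z / A) hL1' ((2 * ⌈dist (Site.toComplex u) z⌉₊ + 3) ^ 2)
  have hc0 : 0 ≤ max C 0 * B ^ (-κ) := mul_nonneg (le_max_right _ _) hBκ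
  calc max C 0 * B ^ (-κ) * _ ≤ max C 0 * B ^ (-κ) * max K₀ 0 :=
        mul_le_mul_of_nonneg_left (hD.trans (le_max_left _ _)) hc0
    _ = max C 0 * max K₀ 0 * B ^ (-κ) := by ring

end Summit.CriticalPhenomena.SAWScalingLimit.Theorems.AnnularMassDecay.Radial

end
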